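import Summits.BirchSwinnertonDyer.BirchSwinnertonDyer.Theorems.ResidualThetaTransportAtTwoSignedMuVanishingAtTwoPlusNeronMu
import Summits.BirchSwinnertonDyer.BirchSwinnertonDyer.Theorems.ResidualThetaTransportAtTwoSignedMuVanishingAtTwoPlusFlatLayer
import Summits.BirchSwinnertonDyer.BirchSwinnertonDyer.Theorems.ResidualThetaTransportAtTwoSignedMuVanishingAtTwoPlusResidual
import HarnessLib

/-!
# Route `ResidualThetaTransportAtTwo`, crux Kμ⁺ `SignedMuVanishingAtTwoPlus` (stmt-BirchSwinnertonDyer-20689):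
# the analytic child `SignedMuAnalyticAtTwoPlus` (stmt-21437) ⟺ «`v₂(ϖ) + μ(L♭_f) = 0` on the habitat⁺»,
# the `Ω_W`-normalised layer certificate, and the refuter door

Cell `bsd-wall`, width seat `bsd-wall-rtt-p4-w2` on the lead line `birth` (skeleton v3). THEOREMS ONLY (no
`def`, no named fact, no `sorry`); helper `--supports` the crux; nothing about any curve is asserted and BSD
is not proved by this. Thin route-level companion of the route-independent `…SignedMuVanishingAtTwoPlusNeronMu`
(this seat: `μ(G) = m + v₂(ϖ) + μ(L♭)`, so the bookkeeping at `W` ⟺ `v₂(ϖ) + μ(L♭) = 0` ⟺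
`μ(L♭_f) = v₂(Ω_W/Ω⁺_f)`) and of the width seat rtt-p4-w3's `…SignedMuVanishingAtTwoPlusFlatLayer` (p578368:
`2 ∤ L♭` ⟺ some even Mazur–Tate layer `θ_n(f)` has a `2`-adic unit coefficient).

* §1 **EXACT READING of the child, no Abbes–Ullmo**: `signedMuAnalyticAtTwoPlus_iff_padicValRat_add_mu_eq_zero`
  — `SignedMuAnalyticAtTwoPlus` ⟺ for every habitat⁺ curve `W`, its newform `f`, the period ratio `ϖ`
  (`ϖ Ω_W = Ω⁺_f`) and every Pollack pair `(L♯, L♭)` at `2`: `v₂(ϖ) + μ(L♭) = 0`. The line's split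
  (PER `v₂(ϖ) = 0`) ∧ (FLAT `μ(L♭) = 0`) is thus sufficient, and necessary exactly up to classes where a `2` in
  the period index would be cancelled by `μ(L♭_f) ≥ 1` (excluded on the habitat by Abbes–Ullmo Thm. A);
  `signedMuVanishingAtTwoPlus_iff_residualFinite_and_padicValRat_add_mu_eq_zero` — the WHOLE CRUX ⟺
  (RESID: finite `X⁺/2X⁺`, the lead's p570516) ∧ (NÉRON-`μ`: `v₂(ϖ) + μ(L♭) = 0`), kernel-exact, no print fact.
* §2 **`Ω_W`-NORMALISED LAYER CERTIFICATE** (the engines divide modular symbols by the Néron period `Ω_W`, i.e.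
  read `θ_n(W) := ϖ · θ_n(f)`): granted the period unit at `W`, `max_j |θ_n(W)_j|₂ = max_j |θ_n(f)_j|₂`, so ONE
  even layer with `max_j |θ_n(W)_j|₂ = 1` gives `2 ∤ L♭` (`not_two_dvd_flat_of_supNorm_neronLayer_eq_one`, via
  rtt-p4-w3's `not_two_dvd_flat_of_supNorm_mazurTateElement_eq_one`) and hence the bookkeeping `μ(G) = m` at `W`
  for every admissible `(G, m)` (`mu_eq_of_isPollackPair_two_of_periodUnit_of_supNorm_neronLayer_eq_one`,
  `…_of_abbesUllmo_…` on the habitat) — the layer-`n`, Néron-normalised upgrade of the lead's layer-`0`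
  certificate `…_of_norm_LValue_eq_one` (odd `L(W,1)/Ω_W`), usable on classes with EVEN `L(W,1)/Ω_W`.
* §3 **REFUTER DOOR**: a habitat⁺ curve with `v₂(ϖ) + μ(L♭) ≠ 0` — in particular one with a period unit and
  `2 ∣ L♭` (by `…FlatLayer`: NO even layer of `θ_n(f)` has a unit coefficient) — refutes the child and the crux
  (`not_signedMuAnalyticAtTwoPlus_of_padicValRat_add_mu_ne_zero`,
  `not_signedMuVanishingAtTwoPlus_of_padicValRat_add_mu_ne_zero`,
  `not_signedMuVanishingAtTwoPlus_of_periodUnit_of_two_dvd_flat`).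

References: R. Greenberg, V. Vatsal, Invent. Math. 142 (2000) p. 2 (2), §3 Rem. 3.4 [GreenbergVatsal2000];
R. Pollack, Duke Math. J. 118 (2003) Prop. 6.18 [Pollack2003]; R. Pollack, T. Weston, Duke Math. J. 156 (2011)
§3.1 [PollackWeston2011MT]; A. Abbes, E. Ullmo, Compositio Math. 103 (1996) Thm. A [AbbesUllmo1996].
-/

set_option autoImplicit false
set_option linter.dupNamespace false

noncomputable section

open scoped Classical MatrixGroups ModularForm

open CongruenceSubgroup WeierstrassCurve Literature.NumberTheory.EllipticCurves
  Literature.NumberTheory.EllipticCurves.ModularForms Literature.NumberTheory.EllipticCurves.Rank1Residual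
  Summit.BirchSwinnertonDyer.Rank1Residual.Supersingular Summit.BirchSwinnertonDyer.Rank1Residual.X1
  Summit.BirchSwinnertonDyer.BirchSwinnertonDyer.Theses.ResidualThetaTransportAtTwo

namespace Summit.BirchSwinnertonDyer.BirchSwinnertonDyer.Theorems.SignedMuAtTwo

/-! ## §1. The analytic child ⟺ `v₂(ϖ) + μ(L♭) = 0` on the habitat⁺ -/

/-- **EXACT READING of the analytic child 21437 (no Abbes–Ullmo).** `SignedMuAnalyticAtTwoPlus` holds iff
for every habitat⁺ curve `W`, its newform `f`, the period ratio `ϖ` and every Pollack pair `(L♯, L♭)` at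
`2`: `v₂(ϖ) + μ(L♭) = 0` ("`μ` of the Néron-normalised flat `2`-adic `L`-function `ϖ L♭_f` vanishes"). The
cyclotomic variable `γ` of the child is inhabited (`exists_isCyclotomic_isTopGenerator_isCyclotomicVariable`)
and otherwise idle. [cite: GreenbergVatsal2000, p. 2, (2) and §3, Remark 3.4] [cite: Pollack2003, Prop. 6.18] -/
theorem signedMuAnalyticAtTwoPlus_iff_padicValRat_add_mu_eq_zero :
    SignedMuAnalyticAtTwoPlus ↔
      ∀ (W : WeierstrassCurve ℚ) [W.IsElliptic] [W.IsGloballyMinimal], ¬ W.HasCM →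
        W.analyticRank = 0 → GoodSS W 2 → W.frobeniusTrace 2 = 0 → W.Δ < 0 →
        ∀ [NeZero (W.conductorNorm ℤ)] (f : CuspForm (Gamma0 (W.conductorNorm ℤ)) 2), IsNewformOf W f →
        ∀ (ϖ : ℚ), (ϖ : ℝ) * W.realPeriodRat = plusPeriod f →
        ∀ (Lplus Lminus : IwasawaAlgebra 2), IsPollackPair f 2 Lplus Lminus →
        padicValRat 2 ϖ + MuLambda.mu Lminus = 0 := by
  constructor
  · intro h W _ _ hCM hr hss ha hΔ _ f hf ϖ hϖ Lplus Lminus hP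
    obtain ⟨κ, -, γ, -, hγ⟩ := exists_isCyclotomic_isTopGenerator_isCyclotomicVariable_holds 2
    exact (forall_mu_eq_iff_padicValRat_add_mu_eq_zero hf hϖ hP).mp
      (h W hCM hr hss ha hΔ γ hγ f hf ϖ hϖ Lplus Lminus hP)
  · intro h W _ _ hCM hr hss ha hΔ γ _ _ f hf ϖ hϖ Lplus Lminus hP G m hG
    exact (forall_mu_eq_iff_padicValRat_add_mu_eq_zero hf hϖ hP).mpr
      (h W hCM hr hss ha hΔ f hf ϖ hϖ Lplus Lminus hP) G m hG

/-- The same against the period index: `SignedMuAnalyticAtTwoPlus` iff for every habitat⁺ `W`, newform `f`,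
`u ∈ ℚ` with `Ω_W = u · Ω⁺_f`, and Pollack pair at `2`: **`μ(L♭_f) = v₂(u) = v₂(Ω_W/Ω⁺_f)`** (`Ω⁺_f > 0`,
so `ϖ = u⁻¹` exists). [cite: GreenbergVatsal2000, §3, Remark 3.4] [cite: Pollack2003, Prop. 6.18] -/
theorem signedMuAnalyticAtTwoPlus_iff_mu_eq_padicValRat_periodIndex :
    SignedMuAnalyticAtTwoPlus ↔
      ∀ (W : WeierstrassCurve ℚ) [W.IsElliptic] [W.IsGloballyMinimal], ¬ W.HasCM →
        W.analyticRank = 0 → GoodSS W 2 → W.frobeniusTrace 2 = 0 → W.Δ < 0 →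
        ∀ [NeZero (W.conductorNorm ℤ)] (f : CuspForm (Gamma0 (W.conductorNorm ℤ)) 2), IsNewformOf W f →
        ∀ (u : ℚ), W.realPeriodRat = u * plusPeriod f →
        ∀ (Lplus Lminus : IwasawaAlgebra 2), IsPollackPair f 2 Lplus Lminus →
        (MuLambda.mu Lminus : ℤ) = padicValRat 2 u := by
  rw [signedMuAnalyticAtTwoPlus_iff_padicValRat_add_mu_eq_zero]
  constructor
  · intro h W _ _ hCM hr hss ha hΔ _ f hf u hΩ Lplus Lminus hP
    have hΩpos : 0 < W.realPeriodRat := W.realPeriodRat_pos_holds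
    have hu0 : u ≠ 0 := by rintro rfl; rw [Rat.cast_zero, zero_mul] at hΩ; exact hΩpos.ne' hΩ
    have hu0' : (u : ℝ) ≠ 0 := by exact_mod_cast hu0
    have hϖ : ((u⁻¹ : ℚ) : ℝ) * W.realPeriodRat = plusPeriod f := by
      rw [hΩ, Rat.cast_inv, ← mul_assoc, inv_mul_cancel₀ hu0', one_mul]
    exact (forall_mu_eq_iff_mu_eq_padicValRat_periodIndex hf hϖ hΩ hP).mp
      ((forall_mu_eq_iff_padicValRat_add_mu_eq_zero hf hϖ hP).mpr (h W hCM hr hss ha hΔ f hf _ hϖ Lplus Lminus hP))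
  · intro h W _ _ hCM hr hss ha hΔ _ f hf ϖ hϖ Lplus Lminus hP
    have hΩpos : 0 < W.realPeriodRat := W.realPeriodRat_pos_holds
    have hϖ0 : ϖ ≠ 0 := periodRatio_ne_zero hf hϖ
    have hϖ0' : (ϖ : ℝ) ≠ 0 := by exact_mod_cast hϖ0
    have hΩ : W.realPeriodRat = (ϖ⁻¹ : ℚ) * plusPeriod f := by
      rw [← hϖ, Rat.cast_inv, ← mul_assoc, inv_mul_cancel₀ hϖ0', one_mul]
    exact (forall_mu_eq_iff_padicValRat_add_mu_eq_zero hf hϖ hP).mp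
      ((forall_mu_eq_iff_mu_eq_padicValRat_periodIndex hf hϖ hΩ hP).mpr (h W hCM hr hss ha hΔ f hf _ hΩ Lplus Lminus hP))

/-- **KERNEL-EXACT READING OF THE CRUX Kμ⁺ (no Abbes–Ullmo).** `SignedMuVanishingAtTwoPlus` holds iff
(RESID) every finitely generated `+` signed Selmer dual `X⁺` of a habitat⁺ curve over the cyclotomic
`ℤ₂`-extension has finite `X⁺/2X⁺` (the lead's `residualFinite_of_signedMuVanishingAtTwoPlus` /
`muAlgebraic_of_residualFinite`, p570516) AND (NÉRON-`μ`) `v₂(ϖ) + μ(L♭) = 0` for every habitat⁺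
`(W, f, ϖ, L♯, L♭)`. The line `birth` proves the second conjunct from (PER) ∧ (FLAT).
[cite: GreenbergVatsal2000, p. 2–3, (2) and proof of Thm. (1.4)] [cite: Pollack2003, Prop. 6.18] -/
theorem signedMuVanishingAtTwoPlus_iff_residualFinite_and_padicValRat_add_mu_eq_zero :
    SignedMuVanishingAtTwoPlus ↔
      (∀ (W : WeierstrassCurve ℚ) [W.IsElliptic] [W.IsGloballyMinimal], ¬ W.HasCM → W.analyticRank = 0 →
        GoodSS W 2 → W.frobeniusTrace 2 = 0 → W.Δ < 0 →
        ∀ (κ : ZpExtension ℚ 2) (γ : Field.absoluteGaloisGroup ℚ), κ.IsCyclotomic → κ.IsTopGenerator γ →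
        ∀ (D : Kobayashi2003.SignedSelmerDualData W κ γ 1) [Module.Finite (IwasawaAlgebra 2) D.X],
          Finite (D.X ⧸ (IwasawaAlgebra.augIdealP 2 • ⊤ : Submodule (IwasawaAlgebra 2) D.X))) ∧
      (∀ (W : WeierstrassCurve ℚ) [W.IsElliptic] [W.IsGloballyMinimal], ¬ W.HasCM →
        W.analyticRank = 0 → GoodSS W 2 → W.frobeniusTrace 2 = 0 → W.Δ < 0 →
        ∀ [NeZero (W.conductorNorm ℤ)] (f : CuspForm (Gamma0 (W.conductorNorm ℤ)) 2), IsNewformOf W f →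
        ∀ (ϖ : ℚ), (ϖ : ℝ) * W.realPeriodRat = plusPeriod f →
        ∀ (Lplus Lminus : IwasawaAlgebra 2), IsPollackPair f 2 Lplus Lminus →
        padicValRat 2 ϖ + MuLambda.mu Lminus = 0) := by
  constructor
  · intro h
    exact ⟨residualFinite_of_signedMuVanishingAtTwoPlus h,
      signedMuAnalyticAtTwoPlus_iff_padicValRat_add_mu_eq_zero.mp fun W _ _ hCM hr hss ha hΔ ↦
        (h W hCM hr hss ha hΔ).2⟩
  · rintro ⟨hres, hν⟩ W _ _ hCM hr hss ha hΔ
    exact ⟨muAlgebraic_of_residualFinite hres W hCM hr hss ha hΔ,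
      signedMuAnalyticAtTwoPlus_iff_padicValRat_add_mu_eq_zero.mpr hν W hCM hr hss ha hΔ⟩

/-! ## §2. The `Ω_W`-normalised layer certificate -/

section Layer

variable {W : WeierstrassCurve ℚ} [W.IsElliptic] [W.IsGloballyMinimal] {N : ℕ} [NeZero N]
  {f : CuspForm (Gamma0 N) 2}

/-- The norm of a rational constant in `ℚ̄₂` is its `2`-adic norm. [folklore] -/
theorem norm_algebraMap_rat_padicAlgCl (q : ℚ) : ‖algebraMap ℚ (PadicAlgCl 2) q‖ = ‖(q : ℚ_[2])‖ := by
  rw [← PadicAlgCl.norm_extends 2 (q : ℚ_[2]), map_ratCast, eq_ratCast]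

omit [W.IsGloballyMinimal] [NeZero N] in
/-- **Layer certificate, `Ω_W`-normalised (the engines' currency).** Granted the period unit at `W`
(`Ω_W = u Ω⁺_f`, `|u|₂ = 1`), the Néron-normalised layer element `θ_n(W) := ϖ · θ_n(f)` (plus modular symbols
divided by `Ω_W` instead of `Ω⁺_f`) has the same coefficient norms as `θ_n(f)`, so ONE even layer with
`max_j |θ_n(W)_j|₂ = 1` gives `2 ∤ L♭`. [cite: Pollack2003, Prop. 6.18] [cite: GreenbergVatsal2000, §3, Remark 3.4] -/
theorem not_two_dvd_flat_of_supNorm_neronLayer_eq_one {ϖ : ℚ}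
    (hϖ : (ϖ : ℝ) * W.realPeriodRat = plusPeriod f)
    (hu : ∃ u : ℚ, ‖(u : ℚ_[2])‖ = 1 ∧ W.realPeriodRat = u * plusPeriod f)
    {Lplus Lminus : IwasawaAlgebra 2} (hP : IsPollackPair f 2 Lplus Lminus) {n : ℕ} (hn : Even n)
    (h1 : ((Polynomial.C ϖ * mazurTateElement f 2 n).map (algebraMap ℚ (PadicAlgCl 2))).supNorm = 1) :
    ¬ PowerSeries.C (2 : ℤ_[2]) ∣ Lminus := by
  have hϖ1 : ‖(ϖ : ℚ_[2])‖ = 1 := norm_ratCast_periodRatio_eq_one hϖ hu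
  rw [Polynomial.map_mul, Polynomial.map_C, ResidualThetaLayer.supNorm_C_mul, norm_algebraMap_rat_padicAlgCl,
    hϖ1, one_mul] at h1
  exact not_two_dvd_flat_of_supNorm_mazurTateElement_eq_one f hP hn h1

omit [W.IsGloballyMinimal] [NeZero N] in
/-- The `Ω_W`-normalised certificate needs only ONE coefficient: granted the period unit at `W`, one coefficient
of one even layer with `|ϖ · θ_n(f)_j|₂ ≥ 1` gives `2 ∤ L♭` (the other coefficients are automatically
`2`-integral, rtt-p4-w3's `not_two_dvd_flat_of_one_le_norm_coeff_mazurTateElement`). [cite: Pollack2003, Prop. 6.18] -/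
theorem not_two_dvd_flat_of_one_le_norm_coeff_neronLayer {ϖ : ℚ}
    (hϖ : (ϖ : ℝ) * W.realPeriodRat = plusPeriod f)
    (hu : ∃ u : ℚ, ‖(u : ℚ_[2])‖ = 1 ∧ W.realPeriodRat = u * plusPeriod f)
    {Lplus Lminus : IwasawaAlgebra 2} (hP : IsPollackPair f 2 Lplus Lminus) {n : ℕ} (hn : Even n) {j : ℕ}
    (hj : 1 ≤ ‖((ϖ * (mazurTateElement f 2 n).coeff j : ℚ) : ℚ_[2])‖) :
    ¬ PowerSeries.C (2 : ℤ_[2]) ∣ Lminus := by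
  have hϖ1 : ‖(ϖ : ℚ_[2])‖ = 1 := norm_ratCast_periodRatio_eq_one hϖ hu
  rw [Rat.cast_mul, norm_mul, hϖ1, one_mul] at hj
  exact not_two_dvd_flat_of_one_le_norm_coeff_mazurTateElement f hP hn hj

omit [W.IsGloballyMinimal] [NeZero N] in
/-- **PER-CLASS INSTRUMENT KERNEL, granted the period unit at `W`**: one even layer whose Néron-normalised
Mazur–Tate element has a `2`-adic unit coefficient certifies the analytic conjunct of Kμ⁺ at `W`
(`μ(G) = m` for every admissible `(G, m)`). [cite: Pollack2003, Prop. 6.18] [cite: GreenbergVatsal2000, §3, Remark 3.4] -/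
theorem mu_eq_of_isPollackPair_two_of_periodUnit_of_supNorm_neronLayer_eq_one {ϖ : ℚ}
    (hϖ : (ϖ : ℝ) * W.realPeriodRat = plusPeriod f)
    (hu : ∃ u : ℚ, ‖(u : ℚ_[2])‖ = 1 ∧ W.realPeriodRat = u * plusPeriod f)
    {Lplus Lminus : IwasawaAlgebra 2} (hP : IsPollackPair f 2 Lplus Lminus) {n : ℕ} (hn : Even n)
    (h1 : ((Polynomial.C ϖ * mazurTateElement f 2 n).map (algebraMap ℚ (PadicAlgCl 2))).supNorm = 1)
    (G : IwasawaAlgebra 2) (m : ℕ)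
    (hG : iwasawaToPowerSeries 2 G =
      PowerSeries.C ((2 : ℚ_[2]) ^ m * (ϖ : ℚ_[2])) * iwasawaToPowerSeries 2 (kobayashiL 1 Lplus Lminus)) :
    MuLambda.mu G = m :=
  mu_eq_of_isPollackPair_two_of_periodUnit_of_not_two_dvd hϖ hu
    (not_two_dvd_flat_of_supNorm_neronLayer_eq_one hϖ hu hP hn h1) G m hG

/-- **PER-CLASS INSTRUMENT KERNEL on the habitat, granted Abbes–Ullmo** (`GoodSS W 2` ⇒ `W[2]` irreducible,
`2 ∤ N_W`; period unit by `exists_periodUnit_two_of_abbesUllmo`): one even layer of the `Ω_W`-normalised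
Mazur–Tate element with a unit coefficient certifies the analytic conjunct of Kμ⁺ at `W`.
[cite: AbbesUllmo1996, Thm. A] [cite: Pollack2003, Prop. 6.18] -/
theorem mu_eq_of_isPollackPair_two_of_abbesUllmo_of_supNorm_neronLayer_eq_one
    (hAU : abbesUllmo_not_dvd_maninConstant_of_not_dvd_level)
    (hss : GoodSS W 2) (hf : IsNewformOf W f) {ϖ : ℚ}
    (hϖ : (ϖ : ℝ) * W.realPeriodRat = plusPeriod f)
    {Lplus Lminus : IwasawaAlgebra 2} (hP : IsPollackPair f 2 Lplus Lminus) {n : ℕ} (hn : Even n)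
    (h1 : ((Polynomial.C ϖ * mazurTateElement f 2 n).map (algebraMap ℚ (PadicAlgCl 2))).supNorm = 1)
    (G : IwasawaAlgebra 2) (m : ℕ)
    (hG : iwasawaToPowerSeries 2 G =
      PowerSeries.C ((2 : ℚ_[2]) ^ m * (ϖ : ℚ_[2])) * iwasawaToPowerSeries 2 (kobayashiL 1 Lplus Lminus)) :
    MuLambda.mu G = m :=
  mu_eq_of_isPollackPair_two_of_periodUnit_of_supNorm_neronLayer_eq_one hϖ
    (exists_periodUnit_two_of_abbesUllmo hAU hss hf) hP hn h1 G m hG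

end Layer

/-! ## §3. REFUTER DOOR: a habitat⁺ class with `v₂(ϖ) + μ(L♭) ≠ 0` kills the analytic child, hence the crux -/

section Refuter

variable {W : WeierstrassCurve ℚ} [W.IsElliptic] [W.IsGloballyMinimal]

/-- The crux projects onto its analytic child (conjunct 2 verbatim). [folklore] -/
theorem signedMuAnalyticAtTwoPlus_of_signedMuVanishingAtTwoPlus (h : SignedMuVanishingAtTwoPlus) :
    SignedMuAnalyticAtTwoPlus :=
  fun W _ _ hCM hr hss ha hΔ ↦ (h W hCM hr hss ha hΔ).2

/-- **Refuter door (exact).** A habitat⁺ curve `W` with newform `f`, period ratio `ϖ` and a Pollack pair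
`(L♯, L♭)` at `2` such that `v₂(ϖ) + μ(L♭) ≠ 0` refutes the analytic child `SignedMuAnalyticAtTwoPlus`.
[cite: GreenbergVatsal2000, p. 2, (2)] [cite: Pollack2003, Prop. 6.18] -/
theorem not_signedMuAnalyticAtTwoPlus_of_padicValRat_add_mu_ne_zero (hCM : ¬ W.HasCM)
    (hr : W.analyticRank = 0) (hss : GoodSS W 2) (ha : W.frobeniusTrace 2 = 0) (hΔ : W.Δ < 0)
    [NeZero (W.conductorNorm ℤ)] {f : CuspForm (Gamma0 (W.conductorNorm ℤ)) 2} (hf : IsNewformOf W f)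
    {ϖ : ℚ} (hϖ : (ϖ : ℝ) * W.realPeriodRat = plusPeriod f) {Lplus Lminus : IwasawaAlgebra 2}
    (hP : IsPollackPair f 2 Lplus Lminus) (hne : padicValRat 2 ϖ + MuLambda.mu Lminus ≠ 0) :
    ¬ SignedMuAnalyticAtTwoPlus := fun h ↦
  hne (signedMuAnalyticAtTwoPlus_iff_padicValRat_add_mu_eq_zero.mp h W hCM hr hss ha hΔ f hf ϖ hϖ Lplus Lminus hP)

/-- **Refuter door for the crux.** The same witness refutes `SignedMuVanishingAtTwoPlus` (stmt-20689).
[cite: GreenbergVatsal2000, p. 2, (2)] [cite: Pollack2003, Prop. 6.18] -/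
theorem not_signedMuVanishingAtTwoPlus_of_padicValRat_add_mu_ne_zero (hCM : ¬ W.HasCM)
    (hr : W.analyticRank = 0) (hss : GoodSS W 2) (ha : W.frobeniusTrace 2 = 0) (hΔ : W.Δ < 0)
    [NeZero (W.conductorNorm ℤ)] {f : CuspForm (Gamma0 (W.conductorNorm ℤ)) 2} (hf : IsNewformOf W f)
    {ϖ : ℚ} (hϖ : (ϖ : ℝ) * W.realPeriodRat = plusPeriod f) {Lplus Lminus : IwasawaAlgebra 2}
    (hP : IsPollackPair f 2 Lplus Lminus) (hne : padicValRat 2 ϖ + MuLambda.mu Lminus ≠ 0) :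
    ¬ SignedMuVanishingAtTwoPlus := fun h ↦
  not_signedMuAnalyticAtTwoPlus_of_padicValRat_add_mu_ne_zero hCM hr hss ha hΔ hf hϖ hP hne
    (signedMuAnalyticAtTwoPlus_of_signedMuVanishingAtTwoPlus h)

/-- A rational of `2`-adic norm `1` has `v₂ = 0`. [folklore] -/
theorem padicValRat_eq_zero_of_norm_eq_one {q : ℚ} (h : ‖(q : ℚ_[2])‖ = 1) : padicValRat 2 q = 0 := by
  have hq : (q : ℚ_[2]) ≠ 0 := by rintro h0; rw [h0, norm_zero] at h; exact zero_ne_one h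
  have h' := Padic.norm_eq_zpow_neg_valuation hq
  rw [h, Padic.valuation_ratCast] at h'
  have := (zpow_eq_one_iff_right₀ (by norm_num : (0 : ℝ) ≤ 2) (by norm_num : (2 : ℝ) ≠ 1)).mp h'.symm
  omega

/-- **Refuter door, period-unit form.** Granted the period unit at a habitat⁺ curve `W` (e.g. from
Abbes–Ullmo), a Pollack pair at `2` of its newform with `2 ∣ L♭` (`μ(L♭_f) ≥ 1`; by
`not_two_dvd_flat_iff_exists_supNorm_mazurTateElement_eq_one`, equivalently NO even layer of `θ_n(f)` has a
unit coefficient) refutes the crux. [cite: Pollack2003, Prop. 6.18] [cite: GreenbergVatsal2000, §3, Remark 3.4] -/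
theorem not_signedMuVanishingAtTwoPlus_of_periodUnit_of_two_dvd_flat (hCM : ¬ W.HasCM)
    (hr : W.analyticRank = 0) (hss : GoodSS W 2) (ha : W.frobeniusTrace 2 = 0) (hΔ : W.Δ < 0)
    [NeZero (W.conductorNorm ℤ)] {f : CuspForm (Gamma0 (W.conductorNorm ℤ)) 2} (hf : IsNewformOf W f)
    (hu : ∃ u : ℚ, ‖(u : ℚ_[2])‖ = 1 ∧ W.realPeriodRat = u * plusPeriod f)
    {Lplus Lminus : IwasawaAlgebra 2} (hP : IsPollackPair f 2 Lplus Lminus)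
    (h2 : PowerSeries.C (2 : ℤ_[2]) ∣ Lminus) :
    ¬ SignedMuVanishingAtTwoPlus := by
  obtain ⟨u, hu1, hΩ⟩ := hu
  have hΩpos : 0 < W.realPeriodRat := W.realPeriodRat_pos_holds
  have hu0 : u ≠ 0 := by rintro rfl; simp at hu1
  have hu0' : (u : ℝ) ≠ 0 := by exact_mod_cast hu0
  have hϖ : ((u⁻¹ : ℚ) : ℝ) * W.realPeriodRat = plusPeriod f := by
    rw [hΩ, Rat.cast_inv, ← mul_assoc, inv_mul_cancel₀ hu0', one_mul]
  have hv : padicValRat 2 (u⁻¹ : ℚ) = 0 := by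
    rw [padicValRat.inv, padicValRat_eq_zero_of_norm_eq_one hu1, neg_zero]
  have hμ : MuLambda.mu Lminus ≠ 0 := by
    have h2' : ((2 : ℕ) : ℤ_[2]) = 2 := by norm_num
    rw [Ne, mu_eq_zero_iff_not_C_dvd (p := 2) hP.2.1, h2', not_not]
    exact h2
  exact not_signedMuVanishingAtTwoPlus_of_padicValRat_add_mu_ne_zero hCM hr hss ha hΔ hf hϖ hP (by omega)

/-- **Refuter door, layer form (finitely many modular symbols).** Granted the period unit at a habitat⁺ curve
`W`, if for SOME even `n ≥ 2λ(L♭) + 2` the Mazur–Tate element has NO unit coefficient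
(`max_j |θ_n(f)_j|₂ ≠ 1`), then `2 ∣ L♭` (rtt-p4-w3's `supNorm_mazurTateElement_eq_one_of_not_two_dvd_flat`
contraposed) and the crux fails. [cite: Pollack2003, Prop. 6.18] [cite: PollackWeston2011MT, §3.1 and §4] -/
theorem not_signedMuVanishingAtTwoPlus_of_periodUnit_of_supNorm_mazurTateElement_ne_one (hCM : ¬ W.HasCM)
    (hr : W.analyticRank = 0) (hss : GoodSS W 2) (ha : W.frobeniusTrace 2 = 0) (hΔ : W.Δ < 0)
    [NeZero (W.conductorNorm ℤ)] {f : CuspForm (Gamma0 (W.conductorNorm ℤ)) 2} (hf : IsNewformOf W f)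
    (hu : ∃ u : ℚ, ‖(u : ℚ_[2])‖ = 1 ∧ W.realPeriodRat = u * plusPeriod f)
    {Lplus Lminus : IwasawaAlgebra 2} (hP : IsPollackPair f 2 Lplus Lminus) {n : ℕ} (hn : Even n)
    (hle : 2 * MuLambda.lam Lminus + 2 ≤ n)
    (h1 : ((mazurTateElement f 2 n).map (algebraMap ℚ (PadicAlgCl 2))).supNorm ≠ 1) :
    ¬ SignedMuVanishingAtTwoPlus := by
  refine not_signedMuVanishingAtTwoPlus_of_periodUnit_of_two_dvd_flat hCM hr hss ha hΔ hf hu hP ?_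
  by_contra h2
  exact h1 (supNorm_mazurTateElement_eq_one_of_not_two_dvd_flat f hP h2 hn hle)

end Refuter

end Summit.BirchSwinnertonDyer.BirchSwinnertonDyer.Theorems.SignedMuAtTwo

end
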